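import Summits.Parity.GeneralizedHardyLittlewood.Theorems.PrimeLevelFamEdgeIdeaDeltasFamilyDefs
import HarnessLib

/-!
# Route `PrimeLevelFamEdge` — TYPED IDEA DELTAS, deck 14b: `negation` lens — the T-FREE FORM of K_A and
# the PRETENTIOUS TABLE (cell ls-idea, seat ls-idea-lens-20 gen 1, card K-L20-1, §2/§3 of the seat's
# `Sketch_L20_Negation.lean` sha16 0527856a79077ff6; LANDING NOTE typer ls-idea-typ-1 gen 2: VERBATIM up to
# (i) namespace `.L20` → `.Negation`, (ii) the 0-ary `LevelFreeBeyondDiagonal` made PARAMETRIC in the window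
# end `Δ` (so K_A ⟺ `∃ Δ > 1, LevelFreeBeyondDiagonal Δ`), (iii) the file split 14a/14b.)

§2  T-FREE FORM OF K_A (refutation budget).  `MomentsBeyondDiagonal` quantifies `∃ T₁ T₂` over level-free
    tables; it is EQUIVALENT to «for some Δ > 1, every (P, Q, Δ' ∈ (1, Δ]) has SOME pair of level-free
    limits» (`LevelFreeAt`, `LevelFreeBeyondDiagonal Δ`), by choice (KERNEL `kA_iff_levelFreeBeyondDiagonal`).
    So ¬K_A needs no adversarial quantifier over tables: it is the existence, for every Δ > 1, of one
    (P, Q, Δ') whose normalised moments have no limit at rate `1/log q̂` along the primes.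
§3  THE PRETENTIOUS TABLE (the negation lens's adversarial model, Props only): the KMV sums with a general
    coefficient table `x : ℕ → ℝ` in place of `μ` (`mollifierX`, `LhX`, `QhX`, `LevelFreeTwoMomentsX`,
    `RatioLevelFreeAt`), and the model table `x_D = μ² · χ_D` (`pretentiousTable`; the (A)-dictionary
    `μ ≈ χ_D μ²` made exact, `D` FIXED, unconditional); the card records why it fails for `x_D` beyond the
    diagonal at formal grade (sign `χ_D(−q)`; `PretentiousTableRatioKilledBeyond`, NOT asserted) and holds
    below it (`PretentiousTableRatioLevelFreeBelow`, NOT asserted); PROVED `|x_D(m)| ≤ 1`.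

HONESTY: Props + KERNEL GLUE ONLY — no analytic input is proved here; both kill hypotheses and K_A are OPEN;
no summit statement, no exceptional-zero theorem (no Landau–Siegel / Siegel-zero exclusion, no Theorem 1–2 of
arXiv:2211.02515, no repaired Margin232) is proved by this file; typed ≠ proved.
-/

noncomputable section

open scoped MatrixGroups Real
open CongruenceSubgroup Complex Finset Filter Polynomial
open Literature.NumberTheory.EllipticCurves.ModularForms
open Literature.NumberTheory.LFunctions
open Literature.NumberTheory.LFunctions.KMV2000
open Summit.Parity.GeneralizedHardyLittlewood.Theses.PrimeLevelFamEdge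
open Summit.Parity.GeneralizedHardyLittlewood.Theorems.PrimeLevelFamEdgeIdeaDeltas

namespace Summit.Parity.GeneralizedHardyLittlewood.Theorems.PrimeLevelFamEdgeIdeaDeltas.Negation

/-! ## §2 T-free form of K_A (the refutation budget without a quantifier over tables) -/

/-- «Level-free limits exist at `(Δ, P, Q)`»: SOME pair of real numbers `(ℓ, 𝓈)` is the limit of the
normalised first / second mollified moment along the primes at KMV's rates — the tables of
`MomentAsymptotics` with `T₁ Δ P Q = ℓ − linForm Δ P Q`, `T₂ Δ P Q = 𝓈 − secondMomentForm Δ P Q`. -/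
def LevelFreeAt (Δ : ℝ) (P Q : ℝ[X]) : Prop :=
  ∃ ℓ 𝓈 C : ℝ, ∃ q₀ : ℕ, ∀ (q : ℕ) [NeZero q], q.Prime → q₀ ≤ q →
    (∀ n : ℕ, (n : ℝ) ≠ qhat q ^ Δ) →
      ‖LhPQ q P Q (qhat q ^ Δ) -
          ((riemannZeta 2 * ((Real.sqrt (qhat q) / (Δ * Real.log (qhat q)) : ℝ) : ℂ)) *
            ((ℓ : ℝ) : ℂ))‖ ≤ C * Real.sqrt (qhat q) * (Real.log (qhat q))⁻¹ ^ 2 ∧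
      ‖QhPQ q P Q (qhat q ^ Δ) -
          ((2 * riemannZeta 2 ^ 2 * ((qhat q / (Δ ^ 2 * Real.log (qhat q) ^ 2) : ℝ) : ℂ)) *
            ((𝓈 : ℝ) : ℂ))‖ ≤ C * qhat q * (Real.log (qhat q))⁻¹ ^ 3

/-- The T-free K_A on the window `(1, Δ]` beyond the diagonal: every admissible `(P, Q, Δ')`, `Δ' ∈ (1, Δ]`,
has level-free limits (PARAMETRIC in the window end `Δ`; K_A ⟺ `∃ Δ > 1, LevelFreeBeyondDiagonal Δ`). -/
def LevelFreeBeyondDiagonal (Δ : ℝ) : Prop :=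
  ∀ P Q : ℝ[X], Admissible P → IsEvenOrOdd Q →
    ∀ Δ' : ℝ, 1 < Δ' → Δ' ≤ Δ → LevelFreeAt Δ' P Q

/-- KERNEL: K_A ⇒ the T-free form (read the limits off the tables). -/
theorem levelFreeBeyondDiagonal_of_kA (h : MomentsBeyondDiagonal) :
    ∃ Δ : ℝ, 1 < Δ ∧ LevelFreeBeyondDiagonal Δ := by
  obtain ⟨Δ, hΔ, T₁, T₂, hT⟩ := h
  refine ⟨Δ, hΔ, fun P Q hP hQ Δ' h1 h2 ↦ ?_⟩
  obtain ⟨C, q₀, hC⟩ := hT P Q hP hQ Δ' h1 h2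
  exact ⟨linForm Δ' P Q + T₁ Δ' P Q, secondMomentForm Δ' P Q + T₂ Δ' P Q, C, q₀,
    fun q _ hq hq₀ hgen ↦ hC q hq hq₀ hgen⟩

/-- KERNEL: the T-free form ⇒ K_A (choose the limits as tables; they are level-free by construction).
Hence `MomentsBeyondDiagonal ↔ ∃ Δ > 1, LevelFreeBeyondDiagonal Δ`, and ¬K_A is: for every `Δ > 1` some
admissible `(P, Q, Δ' ∈ (1, Δ])` has NO level-free limit pair at KMV's rates. -/
theorem kA_of_levelFreeBeyondDiagonal {Δ : ℝ} (hΔ : 1 < Δ) (hL : LevelFreeBeyondDiagonal Δ) :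
    MomentsBeyondDiagonal := by
  classical
  -- choose the limits (junk values off the admissible range)
  let ℓ : ℝ → ℝ[X] → ℝ[X] → ℝ := fun Δ' P Q ↦
    if h : Admissible P ∧ IsEvenOrOdd Q ∧ 1 < Δ' ∧ Δ' ≤ Δ then
      Classical.choose (hL P Q h.1 h.2.1 Δ' h.2.2.1 h.2.2.2) else 0
  let 𝓈 : ℝ → ℝ[X] → ℝ[X] → ℝ := fun Δ' P Q ↦
    if h : Admissible P ∧ IsEvenOrOdd Q ∧ 1 < Δ' ∧ Δ' ≤ Δ then
      Classical.choose (Classical.choose_spec (hL P Q h.1 h.2.1 Δ' h.2.2.1 h.2.2.2)) else 0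
  refine ⟨Δ, hΔ, fun Δ' P Q ↦ ℓ Δ' P Q - linForm Δ' P Q,
    fun Δ' P Q ↦ 𝓈 Δ' P Q - secondMomentForm Δ' P Q, fun P Q hP hQ Δ' h1 h2 ↦ ?_⟩
  have hcond : Admissible P ∧ IsEvenOrOdd Q ∧ 1 < Δ' ∧ Δ' ≤ Δ := ⟨hP, hQ, h1, h2⟩
  have hspec := Classical.choose_spec (Classical.choose_spec (hL P Q hP hQ Δ' h1 h2))
  obtain ⟨C, q₀, hC⟩ := hspec
  refine ⟨C, q₀, fun q _ hq hq₀ hgen ↦ ?_⟩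
  have hℓ : linForm Δ' P Q + (ℓ Δ' P Q - linForm Δ' P Q) =
      Classical.choose (hL P Q hP hQ Δ' h1 h2) := by
    simp only [ℓ, dif_pos hcond]; ring
  have h𝓈 : secondMomentForm Δ' P Q + (𝓈 Δ' P Q - secondMomentForm Δ' P Q) =
      Classical.choose (Classical.choose_spec (hL P Q hP hQ Δ' h1 h2)) := by
    simp only [𝓈, dif_pos hcond]; ring
  rw [hℓ, h𝓈]
  exact hC q hq hq₀ hgen

/-- KERNEL: the equivalence. -/
theorem kA_iff_levelFreeBeyondDiagonal :
    MomentsBeyondDiagonal ↔ ∃ Δ : ℝ, 1 < Δ ∧ LevelFreeBeyondDiagonal Δ :=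
  ⟨levelFreeBeyondDiagonal_of_kA, fun ⟨_, hΔ, hL⟩ ↦ kA_of_levelFreeBeyondDiagonal hΔ hL⟩

/-! ## §3 The pretentious table — the adversarial coefficient model (Props only) -/

/-- The KMV mollifier with a general real coefficient TABLE `x` in place of `μ`:
`M_{x,P}(f) = ∑_{m ≤ M} λ_f(m) x(m) ψ(m)^{−1} m^{−1/2} P(log(M/m)/log M)`; `x = μ` is `mollifierP`. -/
def mollifierX (q : ℕ) [NeZero q] (x : ℕ → ℝ) (P : ℝ[X]) (M : ℝ)
    (f : CuspForm (Gamma0 q) 2) : ℂ :=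
  ∑ m ∈ Icc 1 ⌊M⌋₊, GL2Family.heckeLambda f m * ((x m : ℝ) : ℂ) *
    (((psi m)⁻¹ * (m : ℝ) ^ (-(1 / 2 : ℝ)) * P.eval (Real.log (M / m) / Real.log M) : ℝ) : ℂ)

/-- The table-`x` first mollified harmonic moment `∑ʰ Q̃(Λ(f,s))(½) M_{x,P}(f)`. -/
def LhX (q : ℕ) [NeZero q] (x : ℕ → ℝ) (P Q : ℝ[X]) (M : ℝ) : ℂ :=
  GL2Family.harmonicSum q 2 (fun f ↦ Qtilde q Q f * mollifierX q x P M f)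

/-- The table-`x` second mollified harmonic moment `∑ʰ |Q̃(Λ(f,s))(½) M_{x,P}(f)|²`. -/
def QhX (q : ℕ) [NeZero q] (x : ℕ → ℝ) (P Q : ℝ[X]) (M : ℝ) : ℂ :=
  GL2Family.harmonicSum q 2 (fun f ↦ ((‖Qtilde q Q f * mollifierX q x P M f‖ ^ 2 : ℝ) : ℂ))

/-- «Level-free two-moment asymptotics for the table `x` on `(Δlo, Δhi]`» at KMV's scales and rates,
with SOME level-free constants `(ℓ, 𝓈)` per `(Δ, P, Q)` (the T-free shape of §2; for `x = μ` and
`(Δlo, Δhi) = (1, Δ)` it is `LevelFreeBeyondDiagonal Δ`). -/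
def LevelFreeTwoMomentsX (x : ℕ → ℝ) (Δlo Δhi : ℝ) : Prop :=
  ∀ P Q : ℝ[X], Admissible P → IsEvenOrOdd Q → ∀ Δ : ℝ, Δlo < Δ → Δ ≤ Δhi →
    ∃ ℓ 𝓈 C : ℝ, ∃ q₀ : ℕ, ∀ (q : ℕ) [NeZero q], q.Prime → q₀ ≤ q →
      (∀ n : ℕ, (n : ℝ) ≠ qhat q ^ Δ) →
        ‖LhX q x P Q (qhat q ^ Δ) -
            ((riemannZeta 2 * ((Real.sqrt (qhat q) / (Δ * Real.log (qhat q)) : ℝ) : ℂ)) *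
              ((ℓ : ℝ) : ℂ))‖ ≤ C * Real.sqrt (qhat q) * (Real.log (qhat q))⁻¹ ^ 2 ∧
        ‖QhX q x P Q (qhat q ^ Δ) -
            ((2 * riemannZeta 2 ^ 2 * ((qhat q / (Δ ^ 2 * Real.log (qhat q) ^ 2) : ℝ) : ℂ)) *
              ((𝓈 : ℝ) : ℂ))‖ ≤ C * qhat q * (Real.log (qhat q))⁻¹ ^ 3

/-- **The pretentious table** `x_D(m) = μ(m)² χ_D(m)` for a quadratic Dirichlet character `χ_D mod D`
(read as a real table: `χ_D(m) ∈ {0, ±1}`), `D` FIXED: bounded, multiplicative, squarefree-supported,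
equal to `μ` on every squarefree `m` all of whose prime factors are inert (`χ_D(p) = −1`) — and at
pretentious distance ZERO from `χ_D`.  The (A)-dictionary `μ ≈ χ_D μ²` made exact and unconditional. -/
def pretentiousTable (D : ℕ) [NeZero D] (χ : DirichletCharacter ℂ D) (m : ℕ) : ℝ :=
  ((ArithmeticFunction.moebius m : ℤ) : ℝ) ^ 2 * (χ (m : ZMod D)).re

/-- **SCALE-FREE level-freeness** of the table-`x` second moment at mollifier exponent `Δ`: for every
two admissible `P₁, P₂` (same `Q`) the RATIO `QhX(q;P₁)/QhX(q;P₂)` converges along the primes to ONE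
level-free limit `F(Δ,P₁,P₂,Q)`.  No commitment to KMV's log-power scales — those are specific to `μ`'s
cancellation `∑ μ(m) m^{−1−s} → 0` (`s → 0`); a general bounded table (e.g. `x_D`, whose Dirichlet series
`∑ μ²χ_D m^{−1−s}` does NOT vanish at `s = 0`) lives at other scales, so the honest model-side notion of
«one level-free main term» is this ratio form (critic E5/D4: a scale mismatch must not pose as a kill). -/
def RatioLevelFreeAt (x : ℕ → ℝ) (Δ : ℝ) : Prop :=
  ∀ P₁ P₂ Q : ℝ[X], Admissible P₁ → Admissible P₂ → IsEvenOrOdd Q →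
    ∃ F : ℝ, ∀ ε : ℝ, 0 < ε → ∃ q₀ : ℕ, ∀ (q : ℕ) [NeZero q], q.Prime → q₀ ≤ q →
      (∀ n : ℕ, (n : ℝ) ≠ qhat q ^ Δ) →
        ‖QhX q x P₁ Q (qhat q ^ Δ) - ((F : ℝ) : ℂ) * QhX q x P₂ Q (qhat q ^ Δ)‖ ≤
          ε * ‖QhX q x P₂ Q (qhat q ^ Δ)‖

/-- «The pretentious table is ratio-level-free BELOW the diagonal» — the model half at KMV's
coefficient-blind grade (`Δ < 1`: the off-diagonal of the Petersson formula is a power saving for ANY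
bounded table by the Weil bound, so `QhX ∼ diag(q;x,P)`, whose `P₁/P₂` ratio is a `q`-free quadratic-form
ratio).  NOT ASSERTED (Prop only); typed ≠ proved. -/
def PretentiousTableRatioLevelFreeBelow (D : ℕ) [NeZero D] (χ : DirichletCharacter ℂ D) : Prop :=
  ∀ Δ : ℝ, 0 < Δ → Δ < 1 → RatioLevelFreeAt (pretentiousTable D χ) Δ

/-- «The pretentious table is level-DEPENDENT BEYOND the diagonal» (the negation lens's adversarial
MODEL of ¬K_A): for real primitive `χ_D`, `D ≥ 3` fixed, at EVERY `Δ > 1` the ratio form fails — the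
resonant Petersson moduli `c ∈ qD·ℕ` carry a main-order term of sign `χ_D(−q)` and `P`-shape
`Δ⁻¹(P″∗P″)(r(q))` (K5-8's resonance law with `β = 1`, no lacunarity needed since `𝔻(x_D, χ_D) = 0`),
present iff `q̂^{2(Δ−1)} > D²`, i.e. for every `Δ > 1` once `q` is large, whose `P`-dependence differs from
the plateau's `P′(1)² + Δ⁻¹∫P″²`; so the `P₁/P₂` ratio has two limit points along `q ≡ ±(non-)residue
mod D`.  FORMAL main-term grade; theorem grade blocked by the same single-modulus block as K_A (BN-7a:
the non-resonant `c = q·k`, `D ∤ k`, remainder).  NOT ASSERTED; evidence for the refutation budget, not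
an input of any door (critic E5: `MomentAsymptotics` quantifies over the ACTUAL `μ`-mollified `LhPQ/QhPQ`,
so a table model refutes nothing as typed). -/
def PretentiousTableRatioKilledBeyond (D : ℕ) [NeZero D] (χ : DirichletCharacter ℂ D) : Prop :=
  χ.IsPrimitive → MulChar.IsQuadratic χ → 3 ≤ D →
    ∀ Δ : ℝ, 1 < Δ → ¬ RatioLevelFreeAt (pretentiousTable D χ) Δ

/-- Bookkeeping (proved): the genuine table `μ` (as a real table) — `mollifierX q μ = mollifierP`-shaped;
we only record that `pretentiousTable` agrees with `μ` on squarefree `m` with all prime factors inert is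
NOT needed formally; what IS used by the card is the trivial pointwise bound `|x_D(m)| ≤ 1`. -/
theorem abs_pretentiousTable_le_one (D : ℕ) [NeZero D] (χ : DirichletCharacter ℂ D) (m : ℕ) :
    |pretentiousTable D χ m| ≤ 1 := by
  unfold pretentiousTable
  have hμ : ((ArithmeticFunction.moebius m : ℤ) : ℝ) ^ 2 ≤ 1 := by
    have h := ArithmeticFunction.abs_moebius_le_one (n := m)
    have h' : |((ArithmeticFunction.moebius m : ℤ) : ℝ)| ≤ 1 := by exact_mod_cast h
    calc ((ArithmeticFunction.moebius m : ℤ) : ℝ) ^ 2 = |((ArithmeticFunction.moebius m : ℤ) : ℝ)| ^ 2 := by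
          rw [sq_abs]
      _ ≤ 1 ^ 2 := by gcongr
      _ = 1 := one_pow 2
  have hχ : |(χ (m : ZMod D)).re| ≤ 1 :=
    (Complex.abs_re_le_norm _).trans (DirichletCharacter.norm_le_one χ _)
  rw [abs_mul]
  calc |((ArithmeticFunction.moebius m : ℤ) : ℝ) ^ 2| * |(χ (m : ZMod D)).re|
      ≤ 1 * 1 := by
        gcongr
        · rw [abs_of_nonneg (sq_nonneg _)]; exact hμ
    _ = 1 := one_mul 1

end Summit.Parity.GeneralizedHardyLittlewood.Theorems.PrimeLevelFamEdgeIdeaDeltas.Negation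

end
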